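import Mathlib
import HarnessLib
import Summits.QuantumFields.QCD.Theorems.ExtinctionBuildsQCD.Negative.ChiralInertia

/-!
# Negative-root counts are stable under a gapped Hermitian perturbation (stub S5)

Linear algebra consumed by `WindowExtinction_of` (line `Sketch`, crux idea
`wall-conditioned-cell-spread`, stmt-QuantumFields-18063).  After the wall Schur complement the
cell operator `S` differs from its block-diagonal part `⊕ S_ii` by an inter-cell coupling that is
small in operator norm; off resonance no `S_ii` has an eigenvalue within `ε` of `0`, so the
negative-root count `n₋(M) = #{roots z of charpoly M | re z < 0}` (with multiplicity, written
inline as `M.charpoly.roots.countP (fun z => z.re < 0)`) of `S` equals that of `⊕ S_ii`.  This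
file is the abstract Weyl-type stability statement behind that step:

`stub_negCountStableUnderGap` — if `A` is Hermitian with no characteristic root `z` with
`|re z| ≤ ε`, and `E` is Hermitian with `‖E v‖² ≤ ε² ‖v‖²` for all `v`, then `n₋(A + E) = n₋(A)`.

Proof (Sylvester counting, no perturbation series).  Let `U` be Mathlib's eigenvector unitary of `A`
and `λ` its eigenvalue enumeration; the gap says `|λ_i| > ε` for all `i`.  For `v = U w` with `w`
supported on `{i | λ_i < 0} = {i | λ_i < -ε}` the form `Re⟨v, A v⟩ = Σ λ_i ‖(U† v)_i‖²`
(`re_form_eq_sum_eigenvalues` of `Theorems/ExtinctionBuildsQCD/Negative/ChiralInertia`) is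
`< -ε ‖v‖²` off `w = 0`, while Cauchy–Schwarz and the quadratic bound give `|Re⟨v, E v⟩| ≤ ε ‖v‖²`;
so the form of `A + E` is negative definite on a subspace of dimension `#{i | λ_i < 0}`, and
symmetrically positive definite on one of dimension `#{i | 0 < λ_i}`.  The two dimensions add up to
`card n` (no zero eigenvalue), so the tree's chiral inertia count `countP_neg_eq_of_chiral` gives
`n₋(A + E) = #{i | λ_i < 0} = n₋(A)`.  Reference: Horn–Johnson, *Matrix Analysis*, §4.3 (Weyl's
inequalities) and §4.5 (Sylvester's law of inertia).
-/

namespace Summit.QuantumFields.QCD.Cruxes.WindowExtinction.WallConditionedCellSpread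

open Matrix
open scoped BigOperators
open Summit.QuantumFields.QCD.Theorems.ExtinctionBuildsQCD.Negative

section GapStability

variable {n : Type*}

/-- Extension by zero from the coordinates in a subtype `{i // p i}` vanishes off `p`. -/
theorem negCountStableUnderGap_extend_apply_of_not (p : n → Prop) (c : {i // p i} → ℂ) {i : n}
    (hi : ¬ p i) : Function.ExtendByZero.linearMap ℂ (Subtype.val : {i // p i} → n) c i = 0 := by
  rw [Function.ExtendByZero.linearMap_apply,
    Function.extend_apply' _ _ _ (fun ⟨a, ha⟩ => hi (ha ▸ a.2)), Pi.zero_apply]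

/-- Extension by zero from the coordinates in a subtype `{i // p i}` kills only `0`. -/
theorem negCountStableUnderGap_extend_ne_zero (p : n → Prop) {c : {i // p i} → ℂ} (hc : c ≠ 0) :
    Function.ExtendByZero.linearMap ℂ (Subtype.val : {i // p i} → n) c ≠ 0 := by
  obtain ⟨j, hj⟩ : ∃ j, c j ≠ 0 := Function.ne_iff.mp hc
  refine Function.ne_iff.mpr ⟨j.val, ?_⟩
  rwa [Function.ExtendByZero.linearMap_apply, Subtype.val_injective.extend_apply, Pi.zero_apply]

variable [Fintype n]

/-- From the quadratic bound `‖E v‖² ≤ ε² ‖v‖²` (all `v`) one gets `|Re⟨v, E v⟩| ≤ ε ‖v‖²`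
(Cauchy–Schwarz in `EuclideanSpace ℂ n`). -/
theorem negCountStableUnderGap_abs_re_form_le (E : Matrix n n ℂ) {ε : ℝ} (hε : 0 ≤ ε)
    (hE : ∀ v : n → ℂ, ∑ i, ‖(E *ᵥ v) i‖ ^ 2 ≤ ε ^ 2 * ∑ i, ‖v i‖ ^ 2) (v : n → ℂ) :
    |(star v ⬝ᵥ (E *ᵥ v)).re| ≤ ε * ∑ i, ‖v i‖ ^ 2 := by
  have hxn : ‖(WithLp.toLp 2 v : EuclideanSpace ℂ n)‖ ^ 2 = ∑ i, ‖v i‖ ^ 2 := by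
    rw [EuclideanSpace.norm_sq_eq]
  have hyn : ‖(WithLp.toLp 2 (E *ᵥ v) : EuclideanSpace ℂ n)‖ ^ 2 = ∑ i, ‖(E *ᵥ v) i‖ ^ 2 := by
    rw [EuclideanSpace.norm_sq_eq]
  have hinner : star v ⬝ᵥ (E *ᵥ v) = inner ℂ (WithLp.toLp 2 v : EuclideanSpace ℂ n)
      (WithLp.toLp 2 (E *ᵥ v) : EuclideanSpace ℂ n) := by
    rw [EuclideanSpace.inner_toLp_toLp, dotProduct_comm]
  have hy_le : ‖(WithLp.toLp 2 (E *ᵥ v) : EuclideanSpace ℂ n)‖ ≤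
      ε * ‖(WithLp.toLp 2 v : EuclideanSpace ℂ n)‖ := by
    rw [← sq_le_sq₀ (norm_nonneg _) (mul_nonneg hε (norm_nonneg _)), mul_pow, hyn, hxn]
    exact hE v
  calc |(star v ⬝ᵥ (E *ᵥ v)).re|
      = |(inner ℂ (WithLp.toLp 2 v : EuclideanSpace ℂ n)
          (WithLp.toLp 2 (E *ᵥ v) : EuclideanSpace ℂ n)).re| := by rw [hinner]
    _ ≤ ‖inner ℂ (WithLp.toLp 2 v : EuclideanSpace ℂ n)
          (WithLp.toLp 2 (E *ᵥ v) : EuclideanSpace ℂ n)‖ := Complex.abs_re_le_norm _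
    _ ≤ ‖(WithLp.toLp 2 v : EuclideanSpace ℂ n)‖ *
          ‖(WithLp.toLp 2 (E *ᵥ v) : EuclideanSpace ℂ n)‖ := norm_inner_le_norm _ _
    _ ≤ ‖(WithLp.toLp 2 v : EuclideanSpace ℂ n)‖ *
          (ε * ‖(WithLp.toLp 2 v : EuclideanSpace ℂ n)‖) :=
        mul_le_mul_of_nonneg_left hy_le (norm_nonneg _)
    _ = ε * ∑ i, ‖v i‖ ^ 2 := by rw [← hxn]; ring

variable [DecidableEq n]

/-- The eigenvector unitary `U` of a Hermitian matrix preserves the squared Euclidean norm,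
`Σ ‖(U w) i‖² = Σ ‖w i‖²` (through `Σ ‖x i‖² = Re (star x ⬝ᵥ x)` and `Uᴴ U = 1`). -/
theorem negCountStableUnderGap_sum_norm_sq_eigenvectorUnitary_mulVec {A : Matrix n n ℂ}
    (hA : A.IsHermitian) (w : n → ℂ) :
    ∑ i, ‖((hA.eigenvectorUnitary : Matrix n n ℂ) *ᵥ w) i‖ ^ 2 = ∑ i, ‖w i‖ ^ 2 := by
  have hUU :
      (hA.eigenvectorUnitary : Matrix n n ℂ)ᴴ * (hA.eigenvectorUnitary : Matrix n n ℂ) = 1 := by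
    have := Matrix.mem_unitaryGroup_iff'.1 (hA.eigenvectorUnitary).2
    simpa [Matrix.star_eq_conjTranspose] using this
  have hre : ∀ x : n → ℂ, ∑ i, ‖x i‖ ^ 2 = (star x ⬝ᵥ x).re := fun x => by
    rw [dotProduct, Complex.re_sum]
    refine Finset.sum_congr rfl fun i _ => ?_
    rw [Pi.star_apply, Complex.star_def, ← Complex.normSq_eq_conj_mul_self, Complex.ofReal_re,
      Complex.normSq_eq_norm_sq]
  rw [hre ((hA.eigenvectorUnitary : Matrix n n ℂ) *ᵥ w), hre w, star_mulVec, ← dotProduct_mulVec,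
    mulVec_mulVec, hUU, one_mulVec]

/-- **Definiteness of `A + E` on a spectral sector of `A`.**  Let `A` be Hermitian with eigenvector
unitary `U` and eigenvalues `λ`, let `E` satisfy `‖E v‖² ≤ ε² ‖v‖²`, let `|s| ≤ 1`, and let `p` be a
set of indices on which `ε < s λ_i`.  Then `s · Re⟨v, (A + E) v⟩ > 0` for every `v = U w` with
`w ≠ 0` supported on `p`: in eigen-coordinates `s · Re⟨v, A v⟩ = Σ s λ_i ‖w i‖² > ε Σ ‖w i‖²`
(`re_form_eq_sum_eigenvalues`), while `|Re⟨v, E v⟩| ≤ ε ‖v‖² = ε Σ ‖w i‖²`. -/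
theorem negCountStableUnderGap_form_pos {A : Matrix n n ℂ} (hA : A.IsHermitian) (E : Matrix n n ℂ)
    {ε : ℝ} (hε : 0 ≤ ε) (hE : ∀ v : n → ℂ, ∑ i, ‖(E *ᵥ v) i‖ ^ 2 ≤ ε ^ 2 * ∑ i, ‖v i‖ ^ 2)
    {s : ℝ} (hs : |s| ≤ 1) (p : n → Prop) (hp : ∀ i, p i → ε < s * hA.eigenvalues i)
    (w : n → ℂ) (hw : ∀ i, ¬ p i → w i = 0) (hw0 : w ≠ 0) :
    0 < s * (star ((hA.eigenvectorUnitary : Matrix n n ℂ) *ᵥ w) ⬝ᵥ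
      ((A + E) *ᵥ ((hA.eigenvectorUnitary : Matrix n n ℂ) *ᵥ w))).re := by
  set U : Matrix n n ℂ := (hA.eigenvectorUnitary : Matrix n n ℂ) with hU
  have hUU : Uᴴ * U = 1 := by
    have := Matrix.mem_unitaryGroup_iff'.1 (hA.eigenvectorUnitary).2
    simpa [Matrix.star_eq_conjTranspose] using this
  set v := U *ᵥ w with hv
  have hUv : Uᴴ *ᵥ v = w := by rw [hv, mulVec_mulVec, hUU, one_mulVec]
  have hnorm : ∑ i, ‖v i‖ ^ 2 = ∑ i, ‖w i‖ ^ 2 :=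
    negCountStableUnderGap_sum_norm_sq_eigenvectorUnitary_mulVec hA w
  -- the `A`-form in eigen-coordinates
  have hAform : (star v ⬝ᵥ (A *ᵥ v)).re = ∑ i, hA.eigenvalues i * ‖w i‖ ^ 2 := by
    rw [re_form_eq_sum_eigenvalues hA v, ← hU, hUv]
  -- strict lower bound for the `A`-form on the sector
  have hAlt : ε * ∑ i, ‖w i‖ ^ 2 < s * (star v ⬝ᵥ (A *ᵥ v)).re := by
    rw [hAform, Finset.mul_sum, Finset.mul_sum]
    refine Finset.sum_lt_sum (fun i _ => ?_) ?_
    · by_cases hi : p i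
      · rw [← mul_assoc]
        exact mul_le_mul_of_nonneg_right (hp i hi).le (by positivity)
      · rw [hw i hi, norm_zero]
        simp
    · obtain ⟨j, hj⟩ : ∃ j, w j ≠ 0 := Function.ne_iff.mp hw0
      have hpj : p j := by
        by_contra h
        exact hj (hw j h)
      refine ⟨j, Finset.mem_univ _, ?_⟩
      rw [← mul_assoc]
      exact mul_lt_mul_of_pos_right (hp j hpj) (pow_pos (norm_pos_iff.mpr hj) 2)
  -- the `E`-form is small
  have hEle : |(star v ⬝ᵥ (E *ᵥ v)).re| ≤ ε * ∑ i, ‖w i‖ ^ 2 := by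
    rw [← hnorm]
    exact negCountStableUnderGap_abs_re_form_le E hε hE v
  have hEs : -(ε * ∑ i, ‖w i‖ ^ 2) ≤ s * (star v ⬝ᵥ (E *ᵥ v)).re := by
    have h1 : |s * (star v ⬝ᵥ (E *ᵥ v)).re| ≤ ε * ∑ i, ‖w i‖ ^ 2 := by
      rw [abs_mul]
      calc |s| * |(star v ⬝ᵥ (E *ᵥ v)).re| ≤ 1 * (ε * ∑ i, ‖w i‖ ^ 2) :=
            mul_le_mul hs hEle (abs_nonneg _) zero_le_one
        _ = ε * ∑ i, ‖w i‖ ^ 2 := one_mul _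
    have h2 := neg_abs_le (s * (star v ⬝ᵥ (E *ᵥ v)).re)
    linarith
  rw [add_mulVec, dotProduct_add, Complex.add_re, mul_add]
  linarith

end GapStability

/-- **S5 — Weyl stability of the negative-root count under a gapped Hermitian perturbation.**
If `A` is Hermitian with no characteristic root `z` with `|re z| ≤ ε` (`0 ≤ ε`), and `E` is
Hermitian with `Σ ‖(E v) i‖² ≤ ε² Σ ‖v i‖²` for all `v` (operator norm `≤ ε`), then `A + E` and `A`
have the same number of characteristic roots with negative real part, counted with multiplicity.
Proof: the form of `A + E` is negative definite on the `U`-image of the coordinates `{i | λ_i < 0}`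
and positive definite on that of `{i | 0 < λ_i}` (`negCountStableUnderGap_form_pos`); these have
complementary dimensions because no `λ_i` vanishes, so `countP_neg_eq_of_chiral` (tree,
`ChiralInertia`) counts `n₋(A + E) = #{i | λ_i < 0} = n₋(A)` (`countP_roots_charpoly_eq_card`). -/
theorem stub_negCountStableUnderGap :
    ∀ {n : Type*} [Fintype n] [DecidableEq n] (A E : Matrix n n ℂ) (ε : ℝ), A.IsHermitian →
      E.IsHermitian → 0 ≤ ε → (∀ z ∈ A.charpoly.roots, ε < |z.re|) →
      (∀ v : n → ℂ, ∑ i, ‖(E.mulVec v) i‖ ^ 2 ≤ ε ^ 2 * ∑ i, ‖v i‖ ^ 2) →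
      (A + E).charpoly.roots.countP (fun z => z.re < 0) =
        A.charpoly.roots.countP (fun z => z.re < 0) := by
  intro n _ _ A E ε hA hE hε hgap hEb
  -- the gap in terms of Mathlib's eigenvalue enumeration
  have hgap' : ∀ i, ε < |hA.eigenvalues i| := fun i => by
    have hmem : ((hA.eigenvalues i : ℝ) : ℂ) ∈ A.charpoly.roots := by
      rw [hA.roots_charpoly_eq_eigenvalues]
      exact Multiset.mem_map_of_mem _ (Finset.mem_univ_val i)
    simpa only [Complex.ofReal_re] using hgap _ hmem
  have hAE : (A + E).IsHermitian := hA.add hE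
  set U : Matrix n n ℂ := (hA.eigenvectorUnitary : Matrix n n ℂ) with hU
  -- the two spectral sectors, included through extension by zero and `U`
  set extp := Function.ExtendByZero.linearMap ℂ (Subtype.val : {i // 0 < hA.eigenvalues i} → n)
  set extm := Function.ExtendByZero.linearMap ℂ (Subtype.val : {i // hA.eigenvalues i < 0} → n)
  have hpos : ∀ c : {i // 0 < hA.eigenvalues i} → ℂ, c ≠ 0 →
      0 < (star ((Matrix.mulVecLin U ∘ₗ extp) c) ⬝ᵥ
        ((A + E) *ᵥ (Matrix.mulVecLin U ∘ₗ extp) c)).re := by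
    intro c hc
    have h := negCountStableUnderGap_form_pos hA E hε hEb (s := 1) (by rw [abs_one])
      (fun i => 0 < hA.eigenvalues i)
      (fun i hi => by rw [one_mul, ← abs_of_pos hi]; exact hgap' i) (extp c)
      (fun i hi => negCountStableUnderGap_extend_apply_of_not _ c hi)
      (negCountStableUnderGap_extend_ne_zero _ hc)
    rw [one_mul, ← hU] at h
    simpa only [LinearMap.coe_comp, Function.comp_apply, Matrix.mulVecLin_apply] using h
  have hneg : ∀ c : {i // hA.eigenvalues i < 0} → ℂ, c ≠ 0 →
      (star ((Matrix.mulVecLin U ∘ₗ extm) c) ⬝ᵥ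
        ((A + E) *ᵥ (Matrix.mulVecLin U ∘ₗ extm) c)).re < 0 := by
    intro c hc
    have h := negCountStableUnderGap_form_pos hA E hε hEb (s := -1) (by rw [abs_neg, abs_one])
      (fun i => hA.eigenvalues i < 0)
      (fun i hi => by rw [neg_one_mul, ← abs_of_neg hi]; exact hgap' i) (extm c)
      (fun i hi => negCountStableUnderGap_extend_apply_of_not _ c hi)
      (negCountStableUnderGap_extend_ne_zero _ hc)
    rw [neg_one_mul, Left.neg_pos_iff, ← hU] at h
    simpa only [LinearMap.coe_comp, Function.comp_apply, Matrix.mulVecLin_apply] using h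
  -- no zero eigenvalue: the two sectors have complementary dimensions
  have hcard : Fintype.card {i // 0 < hA.eigenvalues i} + Fintype.card {i // hA.eigenvalues i < 0} =
      Fintype.card n := by
    have hfilter : (Finset.univ.filter fun i => hA.eigenvalues i < 0) =
        Finset.univ.filter fun i => ¬ (0 < hA.eigenvalues i) := by
      refine Finset.filter_congr fun i _ => ⟨fun h => not_lt.mpr h.le, fun h => ?_⟩
      rcases lt_trichotomy (hA.eigenvalues i) 0 with h1 | h1 | h1
      · exact h1
      · have := hgap' i
        rw [h1, abs_zero] at this
        exact absurd hε (not_le.mpr this)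
      · exact absurd h1 h
    rw [Fintype.card_subtype, Fintype.card_subtype, hfilter, Finset.card_filter_add_card_filter_not,
      Finset.card_univ]
  rw [countP_neg_eq_of_chiral hAE _ _ hpos hneg hcard, countP_roots_charpoly_eq_card hA,
    Fintype.card_subtype]
  simp only [Complex.ofReal_re]

end Summit.QuantumFields.QCD.Cruxes.WindowExtinction.WallConditionedCellSpread
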